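import Summits.BirchSwinnertonDyer.BirchSwinnertonDyer.Theorems.ThetaPartnerAtTwoSignedKatoUpToAtTwoLocalTwoTower
import Summits.BirchSwinnertonDyer.Rank1Residual.Additive.KobayashiLayerSaturation
import HarnessLib

/-!
# Route `ThetaPartnerAtTwo` (TP2), crux K3 `SignedKatoDivisibilityUpToAtTwo` (item stmt-BirchSwinnertonDyer-20308),
# line `colemanrat` v3 — THE LOCAL THEORY AT `p = 2`, file 7: Kobayashi's Prop. 8.12 ii) (generation half)
# `E(K_{n,v}) = E⁺(K_{n,v}) + E⁻(K_{n,v})` along the μ-tower `K_{n,v} = ℚ_p(ζ_{p^{n+1}})` at EVERY prime, and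
# UNCONDITIONALLY at `p = 2` (the tree's odd-`p` `KobayashiSignedGenerationDischarge` / `…OfStab` with `p ≠ 2` removed)

HONEST FRAMING (cell `bsd-wall`, lead `bsd-wall-tp2-p2x` g2): THEOREMS ONLY — no definition, no named fact, no
instance, no `sorry`; local theory of the signed (`±`) point groups; nothing about any Selmer group is asserted;
closes no item; BSD is NOT proved by any of this.

## What is proved (`ι : K̄ → ℚ̄_p`, `W/K`, `U : ℕ → Subgroup Γ_K` antitone normal of finite index with LOCAL
## subgroups `(U n)_{ℚ_p} = Stab(ζ_{p^{n+1}})`, `M/ℤ_p` with elliptic fibres, `tr(M ⊗ 𝔽_p) = 0`, `M ⊗ ℚ̄_p = W ⊗ ℚ̄_p`)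

* `localFixedPointsOfEmb_le_sup_towerSigned'` (EVERY prime): `E(K_{n,v}) ≤ E⁺(K_{n,v}) ⊔ E⁻(K_{n,v})` for every
  `n`, granted (i) no `p`-power torsion on the layer points `L(m)`, `m ≥ 1` and (ii) prime-to-`p` saturation of `E₁` —
  the tree's `localFixedPointsOfEmb_le_sup_towerSigned` with Kobayashi's points taken from the all-primes family
  `exists_towerPoints` (file 2) and the all-primes generation step / trace relations (file 3).
* `localFixedPointsOfEmb_le_sup_towerSigned_two_of_stab`, `sup_towerSigned_eq_localFixedPointsOfEmb_two_of_stab`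
  (`p = 2`, model with `2 ∣ a₁`): **`E(K_{n,v}) = E⁺(K_{n,v}) + E⁻(K_{n,v})` along `K_{n,v} = ℚ₂(ζ_{2^{n+1}})` with NO
  torsion / saturation hypothesis** — (i) is Prop. 8.7 at `2` (file 5) and (ii) is the tree's `hsat_of_stab`.
This is Kobayashi's Prop. 8.12 ii) (generation half) AT `p = 2` for the `2`-adic μ-tower — the `±`-decomposition of
the local points over `ℚ(μ_{2^∞})`, input of the `Δ = {±1}`-descent road to `ℚ_∞` (p579683). Not here: the
ℤ₂-tower `ℚ_{2,n}` itself, the intersection `E⁺ ∩ E⁻`, the Coleman maps.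

References: [Kobayashi2003] §8.4 (Lemma 8.9, Prop. 8.11, Prop. 8.12 ii)), Prop. 8.7; [KuriharaOtsuki2006] p. 557;
[Honda1970] Thm. 2.
-/

set_option autoImplicit false
-- the Theorems namespace of this sub repeats the summit name by design (D-0017 nested layout)
set_option linter.dupNamespace false

noncomputable section

open scoped Classical
open Finset

universe u

namespace Summit.BirchSwinnertonDyer.BirchSwinnertonDyer.Theorems

namespace SignedKatoOffTwo.LocalTwo

open Literature.NumberTheory.EllipticCurves Literature.NumberTheory.GaloisRepresentations
  Literature.NumberTheory.EllipticCurves.FormalGroupChart WeierstrassCurve Field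
open Summit.BirchSwinnertonDyer.Rank1Residual.Additive
open Summit.BirchSwinnertonDyer.Rank1Residual.Additive.PadicCyclotomicTower
open Summit.BirchSwinnertonDyer.Rank1Residual.Additive.BallEval
open Summit.BirchSwinnertonDyer.BirchSwinnertonDyer.Theorems.SignedKatoOffTwo.LocalAllPrimes

section Main

variable {p : ℕ} [hp : Fact p.Prime] {K : Type} [Field K] [Algebra K ℚ_[p]]
  (ι : AlgebraicClosure K →ₐ[K] AlgebraicClosure ℚ_[p]) (W : WeierstrassCurve K)
  (U : ℕ → Subgroup (Field.absoluteGaloisGroup K)) [hUf : ∀ n, (U n).FiniteIndex] [hUN : ∀ n, (U n).Normal]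
  (M : WeierstrassCurve ℤ_[p])
  [hE : (M.map PadicInt.Coe.ringHom).IsElliptic] [hEt : (M.map PadicInt.toZMod).IsElliptic]

variable {ι W U M}

/-- **Kobayashi's Prop. 8.12 ii) (generation half) at EVERY prime.** Let `U` be an antitone tower of normal
finite-index subgroups of `Γ_K` whose LOCAL subgroups at `ι` are the stabilisers `Stab(ζ_{p^{n+1}}) ≤ Gal(ℚ̄_p/ℚ_p)`
(`K_{n,v} = ℚ_p(ζ_{p^{n+1}})`), `W/K` with a model `M/ℤ_p` with elliptic fibres, `tr(M ⊗ 𝔽_p) = 0` and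
`M ⊗ ℚ̄_p = W ⊗ ℚ̄_p` — ANY prime `p`. Assume (i) no point of `E(ℚ̄_p)` with coordinates in `ℚ_p(ζ_{p^m})`, `m ≥ 1`,
has non-trivial `p`-power torsion and (ii) every `P ∈ E(K_{n,v})` has a prime-to-`p` multiple in `E₁`. Then
`E(K_{n,v}) ≤ E⁺(K_{n,v}) ⊔ E⁻(K_{n,v})` for every `n`. Proof = the tree's odd-`p` proof with the all-primes tower
points (file 2) and the all-primes generation step and trace relations (file 3). [cite: Kobayashi2003, Prop. 8.12] -/
theorem localFixedPointsOfEmb_le_sup_towerSigned'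
    (htr : Literature.NumberTheory.EllipticCurves.HasseManin.tr (M.map PadicInt.toZMod) = 0)
    (hUa : Antitone U) (hU : ∀ n, localSubgroupOfEmb (U n) ι = stab p (n + 1))
    (hWM : M.baseChange (AlgebraicClosure ℚ_[p]) = W.baseChange (AlgebraicClosure ℚ_[p]))
    (htorsΩ : ∀ m, 1 ≤ m → ∀ Q ∈ subfieldPoints (genFibΩ p M) (layer p m).toSubfield coeffs_mem_layer,
      ∀ k : ℕ, p ^ k • Q = 0 → Q = 0)
    (hsat : ∀ n, ∀ P ∈ localFixedPointsOfEmb ι W (U n), ∃ m' : ℕ, m'.Coprime p ∧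
      ∀ (x y : AlgebraicClosure ℚ_[p]) (hxy : (W.baseChange (AlgebraicClosure ℚ_[p])).toAffine.Nonsingular x y),
        m' • P = .some x y hxy → 1 < ‖x‖)
    (n : ℕ) :
    localFixedPointsOfEmb ι W (U n) ≤
      towerSignedLocalPointsOfEmb U ι W 1 n ⊔ towerSignedLocalPointsOfEmb U ι W (-1) n := by
  have hV : genFibΩ p M = W.baseChange (AlgebraicClosure ℚ_[p]) := (genFibΩ_eq_baseChange M).trans hWM
  haveI hintΩ : (genFibΩ p M).IsIntegral (Valued.v (R := PadicAlgCl p)).integer := isIntegral_genFib_baseChange p M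
  -- notation
  set e := toLoc hV with he
  set act : Field.absoluteGaloisGroup ℚ_[p] → (genFibΩ p M).toAffine.Point → (genFibΩ p M).toAffine.Point :=
    fun σ Q => e.symm (σ • e Q) with hact_def
  have hact0 : ∀ σ, act σ 0 = 0 := fun σ => act_zero hV σ
  have hact : ∀ σ (x y : PadicAlgCl p) (h : (genFibΩ p M).toAffine.Nonsingular x y),
      ∃ h', act σ (Affine.Point.some x y h) = Affine.Point.some (σ • x) (σ • y) h' := fun σ x y h => act_some hV σ x y h
  have he_act : ∀ σ Q, e (act σ Q) = σ • e Q := fun σ Q => by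
    simp only [hact_def, AddEquiv.apply_symm_apply]
  -- layer points and the fixed groups
  have hFix : ∀ k (P : localPoints W ℚ_[p]), P ∈ localFixedPointsOfEmb ι W (U k) ↔
      e.symm P ∈ subfieldPoints (genFibΩ p M) (layer p (k + 1)).toSubfield coeffs_mem_layer :=
    fun k P => mem_localFixedPointsOfEmb_iff_mem_subfieldPoints ι hV hU k P
  have hFixTop : ∀ (P : localPoints W ℚ_[p]), P ∈ localFixedPointsOfEmb ι W ⊤ ↔
      e.symm P ∈ subfieldPoints (genFibΩ p M) (layer p 0).toSubfield coeffs_mem_layer :=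
    fun P => mem_localFixedPointsOfEmb_top_iff_mem_subfieldPoints ι hV P
  -- Kobayashi's points at every prime (file `…LocalTowerPoints`), transported
  obtain ⟨cΩ, hcΩ0, hcΩ⟩ := exists_towerPoints p M htr
  set c : ℕ → localPoints W ℚ_[p] := fun k => e (cΩ (k + 1)) with hc_def
  have hc : ∀ k, c k ∈ localFixedPointsOfEmb ι W (U k) := fun k => by
    rw [hFix, hc_def]; simp only [AddEquiv.symm_apply_apply]; exact (hcΩ (k + 1)).1
  -- finiteness of the Galois quotients
  have hfin : ∀ m, ((stab p (m + 1)).subgroupOf (stab p m)).FiniteIndex := fun m => by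
    refine ⟨?_⟩
    rw [index_subgroupOf_stab_succ]
    split_ifs
    · have := hp.out.two_le; omega
    · exact hp.out.ne_zero
  haveI hFt : ∀ m, Fintype (stab p m ⧸ (stab p (m + 1)).subgroupOf (stab p m)) := fun m =>
    haveI := hfin m; Fintype.ofFinite _
  -- the traces of cc-typer-6, computed over `stab p (k+1) / stab p (k+2)`
  have htrace : ∀ k (Q : (genFibΩ p M).toAffine.Point),
      Q ∈ subfieldPoints (genFibΩ p M) (layer p (k + 2)).toSubfield coeffs_mem_layer →
      localPairTraceOfEmb ι W (U k) (U (k + 1)) (e Q) =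
        e (∑ q : stab p (k + 1) ⧸ (stab p (k + 2)).subgroupOf (stab p (k + 1)),
          act ((q.out : stab p (k + 1)) : Field.absoluteGaloisGroup ℚ_[p]) Q) := by
    intro k Q hQ
    have hQ' : (e Q : localPoints W ℚ_[p]) ∈ localFixedPointsOfEmb ι W (U (k + 1)) := by
      rw [hFix]; simpa using hQ
    have hmem : ∀ τ : Field.absoluteGaloisGroup ℚ_[p], τ ∈ stab p (k + 1) → τ ∈ localSubgroupOfEmb (U k) ι :=
      fun τ hτ => by rw [hU]; exact hτ
    have hmem' : ∀ τ : Field.absoluteGaloisGroup ℚ_[p], τ ∈ localSubgroupOfEmb (U (k + 1)) ι ↔ τ ∈ stab p (k + 2) :=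
      fun τ => by rw [hU]
    let g : (stab p (k + 1) ⧸ (stab p (k + 2)).subgroupOf (stab p (k + 1))) → localSubgroupOfEmb (U k) ι :=
      fun q => ⟨((q.out : stab p (k + 1)) : Field.absoluteGaloisGroup ℚ_[p]), hmem _ q.out.2⟩
    have hg : Function.Bijective fun q => (QuotientGroup.mk (g q) :
        localSubgroupOfEmb (U k) ι ⧸ (localSubgroupOfEmb (U (k + 1)) ι).subgroupOf (localSubgroupOfEmb (U k) ι)) := by
      constructor
      · intro q₁ q₂ hq
        have hq' := QuotientGroup.eq.mp hq
        rw [Subgroup.mem_subgroupOf, Subgroup.coe_mul, Subgroup.coe_inv, hmem'] at hq'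
        rw [← QuotientGroup.out_eq' q₁, ← QuotientGroup.out_eq' q₂, QuotientGroup.eq, Subgroup.mem_subgroupOf,
          Subgroup.coe_mul, Subgroup.coe_inv]
        exact hq'
      · intro r
        obtain ⟨τ, rfl⟩ := QuotientGroup.mk_surjective r
        have hiff : ∀ σ : Field.absoluteGaloisGroup ℚ_[p], σ ∈ localSubgroupOfEmb (U k) ι ↔ σ ∈ stab p (k + 1) :=
          fun σ => by rw [hU]
        have hτ : (τ : Field.absoluteGaloisGroup ℚ_[p]) ∈ stab p (k + 1) := (hiff _).mp τ.2
        refine ⟨QuotientGroup.mk ⟨τ, hτ⟩, ?_⟩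
        change QuotientGroup.mk (g (QuotientGroup.mk ⟨(τ : Field.absoluteGaloisGroup ℚ_[p]), hτ⟩)) = QuotientGroup.mk τ
        rw [QuotientGroup.eq, Subgroup.mem_subgroupOf, Subgroup.coe_mul, Subgroup.coe_inv, hmem']
        have h2 : (((QuotientGroup.mk (s := (stab p (k + 2)).subgroupOf (stab p (k + 1)))
            ⟨(τ : Field.absoluteGaloisGroup ℚ_[p]), hτ⟩).out : stab p (k + 1)) : Field.absoluteGaloisGroup ℚ_[p])⁻¹ *
            τ ∈ stab p (k + 2) := by
          have h3 := QuotientGroup.mk_out_eq_mul (s := (stab p (k + 2)).subgroupOf (stab p (k + 1)))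
            (⟨(τ : Field.absoluteGaloisGroup ℚ_[p]), hτ⟩ : stab p (k + 1))
          obtain ⟨h, hh⟩ := h3
          have hh' := congrArg (fun z : stab p (k + 1) => (z : Field.absoluteGaloisGroup ℚ_[p])) hh
          simp only [Subgroup.coe_mul] at hh'
          rw [hh']
          have hhm : ((h : stab p (k + 1)) : Field.absoluteGaloisGroup ℚ_[p]) ∈ stab p (k + 2) := by
            have := h.2; rw [Subgroup.mem_subgroupOf] at this; exact this
          rw [mul_inv_rev, mul_assoc, inv_mul_cancel, mul_one]
          exact (stab p (k + 2)).inv_mem hhm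
        exact h2
    rw [localPairTraceOfEmb_eq_sum_of_bijective ι W (U k) (U (k + 1)) hQ' g hg, map_sum]
    exact sum_congr rfl fun q _ => (he_act _ Q).symm
  -- trace relations
  have h1 : localPairTraceOfEmb ι W (U 0) (U 1) (c 1) ∈ localFixedPointsOfEmb ι W ⊤ := by
    rw [hc_def]
    rw [htrace 0 (cΩ 2) (hcΩ 2).1, hFixTop, AddEquiv.symm_apply_apply]
    have h := sum_act_add_mem' act hact0 hact (m := 1) le_rfl (htorsΩ 2 (by omega))
      (hcΩ 2).1 (hcΩ 2).2.1 (hcΩ 2).2.2 (hcΩ 0).1 (hcΩ 0).2.1 (hcΩ 0).2.2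
    rwa [hcΩ0, add_zero] at h
  have hrel : ∀ k, localPairTraceOfEmb ι W (U (k + 1)) (U (k + 2)) (c (k + 2)) + c k ∈ localFixedPointsOfEmb ι W ⊤ := by
    intro k
    rw [hc_def]
    rw [htrace (k + 1) (cΩ (k + 3)) (hcΩ (k + 3)).1, ← map_add, hFixTop, AddEquiv.symm_apply_apply]
    exact sum_act_add_mem' act hact0 hact (m := k + 2) (by omega) (htorsΩ (k + 3) (by omega))
      (hcΩ (k + 3)).1 (hcΩ (k + 3)).2.1 (hcΩ (k + 3)).2.2 (hcΩ (k + 1)).1 (hcΩ (k + 1)).2.1 (hcΩ (k + 1)).2.2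
  -- generation
  have hgen : ∀ k, ∀ P ∈ localFixedPointsOfEmb ι W (U (k + 1)),
      ∃ B ∈ AddSubgroup.closure (Set.range fun g : Field.absoluteGaloisGroup ℚ_[p] => g • c (k + 1)),
        P - B ∈ towerSignedLocalPointsOfEmb U ι W (((k + 1 : ℕ) : ℤ).negOnePow) (k + 1) ⊔
          localFixedPointsOfEmb ι W (U k) := by
    intro k P hP
    set S := towerSignedLocalPointsOfEmb U ι W (((k + 1 : ℕ) : ℤ).negOnePow) (k + 1) ⊔ localFixedPointsOfEmb ι W (U k)
      with hS
    -- the index `[K_{k+1,v} : K_{k,v}] = p`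
    have hidx : ((localSubgroupOfEmb (U (k + 1)) ι).subgroupOf (localSubgroupOfEmb (U k) ι)).index = p := by
      rw [hU (k + 1), hU k, index_subgroupOf_stab_succ, if_neg (by omega)]
    have htriv : ∀ R ∈ localFixedPointsOfEmb ι W (U (k + 1)), p • R ∈ S := fun R hR => by
      have h := index_smul_mem_sup U ι W hUa k hR
      rwa [hidx] at h
    -- saturation
    obtain ⟨m', hm'p, hm'⟩ := hsat (k + 1) P hP
    set Q := e.symm P with hQdef
    have hQL : Q ∈ subfieldPoints (genFibΩ p M) (layer p (k + 2)).toSubfield coeffs_mem_layer := (hFix (k + 1) P).mp hP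
    have hmQk : m' • Q ∈ kernel (Valued.v (R := PadicAlgCl p)) (genFibΩ p M) := by
      rw [hQdef, ← map_nsmul, he, toLoc_symm_mem_kernel_iff]
      intro x y hxy hxP
      have := hm' x y hxy hxP
      rwa [PadicAlgCl.valuation_def, ← NNReal.coe_lt_coe, coe_nnnorm, NNReal.coe_one]
    obtain ⟨BΩ, hBΩ, RΩ, hRΩL, -, hgenΩ⟩ := exists_sub_closure_sub_smul_mem' htr act hact0 hact
      (m := k + 2) (by omega) (hcΩ (k + 2)).1 (hcΩ (k + 2)).2.1 (hcΩ (k + 2)).2.2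
      (htorsΩ (k + 2) (by omega)) ((subfieldPoints _ _ _).nsmul_mem hQL m') hmQk
    rw [show k + 2 - 1 = k + 1 from rfl] at hgenΩ
    -- transport back
    set B : localPoints W ℚ_[p] := e BΩ with hBdef
    set R : localPoints W ℚ_[p] := e RΩ with hRdef
    have hBcl : B ∈ AddSubgroup.closure (Set.range fun g : Field.absoluteGaloisGroup ℚ_[p] => g • c (k + 1)) := by
      have himg : (AddSubgroup.closure (Set.range fun σ : Field.absoluteGaloisGroup ℚ_[p] =>
          act σ (cΩ (k + 2)))).map e.toAddMonoidHom ≤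
          AddSubgroup.closure (Set.range fun g : Field.absoluteGaloisGroup ℚ_[p] => g • c (k + 1)) := by
        rw [AddMonoidHom.map_closure]
        refine AddSubgroup.closure_mono ?_
        rintro _ ⟨_, ⟨σ, rfl⟩, rfl⟩
        exact ⟨σ, (he_act σ _).symm⟩
      exact himg ⟨BΩ, hBΩ, rfl⟩
    have hR : R ∈ localFixedPointsOfEmb ι W (U (k + 1)) := by
      rw [hFix, hRdef, AddEquiv.symm_apply_apply]; exact hRΩL
    have hF : m' • P - B - p • R ∈ localFixedPointsOfEmb ι W (U k) := by
      rw [hFix, map_sub, map_sub, map_nsmul, map_nsmul, hBdef, hRdef, AddEquiv.symm_apply_apply,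
        AddEquiv.symm_apply_apply]
      exact hgenΩ
    -- Bezout
    obtain ⟨a, b, hab⟩ := Nat.isCoprime_iff_coprime.mpr hm'p
    refine ⟨a • B, AddSubgroup.zsmul_mem _ hBcl a, ?_⟩
    have hFS : m' • P - B - p • R ∈ S := AddSubgroup.mem_sup_right hF
    have hpR : p • R ∈ S := htriv R hR
    have hpP : p • P ∈ S := htriv P hP
    have key : P - a • B = a • (m' • P - B - p • R) + a • (p • R) + b • (p • P) := by
      have hP1 : P = (a * (m' : ℤ) + b * (p : ℤ)) • P := by rw [hab, one_zsmul]
      conv_lhs => rw [hP1]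
      rw [add_zsmul, mul_zsmul, mul_zsmul, natCast_zsmul, natCast_zsmul, smul_sub, smul_sub]
      abel
    rw [key]
    exact S.add_mem (S.add_mem (S.zsmul_mem hFS a) (S.zsmul_mem hpR a)) (S.zsmul_mem hpP b)
  exact le_sup_towerSigned_of_generators U ι W hUa c hc h1 hrel hgen n


/-- **Kobayashi's Prop. 8.12 ii) (generation half) AT `p = 2`, NO torsion / saturation hypothesis**: for a tower
`U` with local subgroups `Stab(ζ_{2^{n+1}})` (`K_{n,v} = ℚ₂(ζ_{2^{n+1}})`) and a `ℤ₂`-model `M` of `W` with elliptic fibres,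
`2 ∣ a₁(M)` and `a₂(M) = 0`: `E(K_{n,v}) ≤ E⁺(K_{n,v}) ⊔ E⁻(K_{n,v})` for every `n` — (i) by Prop. 8.7 at `2` on every layer
(file 5, `eq_zero_of_two_pow_smul_eq_zero_of_mem_subfieldPoints_layer`), (ii) by the tree's `hsat_of_stab`.
[cite: Kobayashi2003, Prop. 8.12] [cite: KuriharaOtsuki2006, p. 557] -/
theorem localFixedPointsOfEmb_le_sup_towerSigned_two_of_stab {K : Type} [Field K] [Algebra K ℚ_[2]]
    {ι : AlgebraicClosure K →ₐ[K] AlgebraicClosure ℚ_[2]} {W : WeierstrassCurve K}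
    {U : ℕ → Subgroup (Field.absoluteGaloisGroup K)} [∀ n, (U n).FiniteIndex] [∀ n, (U n).Normal]
    {M : WeierstrassCurve ℤ_[2]} [(M.map PadicInt.Coe.ringHom).IsElliptic] [(M.map PadicInt.toZMod).IsElliptic]
    (h₁ : M.a₁ ∈ IsLocalRing.maximalIdeal ℤ_[2])
    (htr : Literature.NumberTheory.EllipticCurves.HasseManin.tr (M.map PadicInt.toZMod) = 0)
    (hUa : Antitone U) (hU : ∀ n, localSubgroupOfEmb (U n) ι = stab 2 (n + 1))
    (hWM : M.baseChange (AlgebraicClosure ℚ_[2]) = W.baseChange (AlgebraicClosure ℚ_[2])) (n : ℕ) :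
    localFixedPointsOfEmb ι W (U n) ≤
      towerSignedLocalPointsOfEmb U ι W 1 n ⊔ towerSignedLocalPointsOfEmb U ι W (-1) n :=
  localFixedPointsOfEmb_le_sup_towerSigned' htr hUa hU hWM
    (fun m _ _ hQ _ hk ↦ eq_zero_of_two_pow_smul_eq_zero_of_mem_subfieldPoints_layer M h₁ m hQ hk)
    (hsat_of_stab htr hU hWM) n

/-- The same as an EQUALITY `E(K_{n,v}) = E⁺(K_{n,v}) ⊔ E⁻(K_{n,v})` along `ℚ₂(ζ_{2^{n+1}})` (`E^± ≤ E` trivially).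
[cite: Kobayashi2003, Prop. 8.12] -/
theorem sup_towerSigned_eq_localFixedPointsOfEmb_two_of_stab {K : Type} [Field K] [Algebra K ℚ_[2]]
    {ι : AlgebraicClosure K →ₐ[K] AlgebraicClosure ℚ_[2]} {W : WeierstrassCurve K}
    {U : ℕ → Subgroup (Field.absoluteGaloisGroup K)} [∀ n, (U n).FiniteIndex] [∀ n, (U n).Normal]
    {M : WeierstrassCurve ℤ_[2]} [(M.map PadicInt.Coe.ringHom).IsElliptic] [(M.map PadicInt.toZMod).IsElliptic]
    (h₁ : M.a₁ ∈ IsLocalRing.maximalIdeal ℤ_[2])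
    (htr : Literature.NumberTheory.EllipticCurves.HasseManin.tr (M.map PadicInt.toZMod) = 0)
    (hUa : Antitone U) (hU : ∀ n, localSubgroupOfEmb (U n) ι = stab 2 (n + 1))
    (hWM : M.baseChange (AlgebraicClosure ℚ_[2]) = W.baseChange (AlgebraicClosure ℚ_[2])) (n : ℕ) :
    towerSignedLocalPointsOfEmb U ι W 1 n ⊔ towerSignedLocalPointsOfEmb U ι W (-1) n =
      localFixedPointsOfEmb ι W (U n) :=
  le_antisymm (sup_le (towerSignedLocalPointsOfEmb_le U ι W 1 n) (towerSignedLocalPointsOfEmb_le U ι W (-1) n))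
    (localFixedPointsOfEmb_le_sup_towerSigned_two_of_stab h₁ htr hUa hU hWM n)

end Main

end SignedKatoOffTwo.LocalTwo

end Summit.BirchSwinnertonDyer.BirchSwinnertonDyer.Theorems

end
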